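import Literature.Probability.RandomPlanarGeometry.YangBaxterSAWStripMonotone
import HarnessLib

/-!
# Glazman–Manolescu, §2.1: the parafermionic observable and Corollary 2.3

Topic `Literature/Probability/RandomPlanarGeometry`; third support file for the discharge of
`Literature.Probability.RandomPlanarGeometry.SAW.YangBaxter.GlazmanManolescu2019_thm1`
(`YangBaxterSAW.lean`, `YangBaxterSAWTwoPoint.lean`, `YangBaxterSAWStripMonotone.lean`):
A. Glazman, I. Manolescu, *Self-avoiding walk on `ℤ²` with Yang–Baxter weights: universality of
critical fugacity and 2-point function*, Ann. Inst. Henri Poincaré Probab. Stat. 56 (2020),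
arXiv:1708.00395 (`GlazmanManolescu2019`), **§2.1** (pp. 5–7). This file reduces the named fact
`GlazmanManolescu2019_cor23` (Corollary 2.3, the strip identity `cos(3π/8) A_{T,Θ} + B_{T,Θ} = 1`,
the first input of Theorem 1) to its two printed ingredients, vendored as named facts:

* `GlazmanManolescu2019_lem21` — **Lemma 2.1**, the partial discrete Cauchy–Riemann relation
  `F(z_E) − F(z_W) = e^{iθ}(F(z_S) − F(z_N))` of the parafermionic observable
  `F(z) = Σ_{γ : 0 → z} w(γ) e^{−i(5/8) wind(γ)}` (`parafermion`) around every rhombus of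
  `Rect_{T,L}(Θ)` ("in the form given in [Gl]"; its proof groups the walks by their trace outside
  the rhombus and uses Nienhuis' weights and a topological evaluation of windings);
* `GlazmanManolescu2019_boundaryWinding` — the values of the winding of a walk of the rectangle
  from `0` to its boundary: `±π` on the left side `α`, `0` on the right side `β` ("the winding of
  any bridge is `0`"), `θ_k` on the top side `δ` and `θ_k − π` on the bottom side `ε` ("walks …
  with endpoint on `δ` and `ε` have winding in `[π/3, 2π/3]` and `[−2π/3, −π/3]`", §2.2; "for
  the points on the boundary we know the winding", [Gl, proof of Lemma 4.1]) — the topological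
  input (Hopf's Umlaufsatz for the walk closed up along `∂Rect`), used without comment in the
  source;

and PROVES from them, as printed:

* `GlazmanManolescu2019_lem22_of` — **Lemma 2.2** (`cos(3π/8) A_{T,L,Θ} + B_{T,L,Θ} + D_{T,L,Θ} + E_{T,L,Θ} = 1`,
  = [Gl, Lem. 4.1]): "Summing the real part of (CR) over all rhombi" — the interior edges cancel
  (`rect_contour_sum`), `F(0) = 1` is "the contribution … of the empty configuration"
  (`parafermion_origin`), and the boundary windings turn the remaining terms into
  `−cos(3π/8) A`, `B`, `D`, `E` (`rectA`, `rectB`, `rectD`, `rectE`, eq. (2.2)–(2.3));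
* `GlazmanManolescu2019_cor23_of` — **Corollary 2.3 from Lemma 2.2**, following the printed
  proof: `A_{T,Θ} = lim_L A_{T,L,Θ}` and `B_{T,Θ} = lim_L B_{T,L,Θ}` as increasing limits
  (`arcPartitionFunction_eq_iSup`, `bridgePartitionFunction_eq_iSup`, by exhaustion of the strip
  by rectangles, `twoPoint_strip_eq_iSup_rect`); `0 ≤ D_{T,L,Θ} ≤ T c^{-T} G_{S_T(Θ)}(0, L+1)`
  by completing every walk to the top side "by at most `T` steps … to form a self-avoiding path
  on `Strip_T(Θ)` with endpoints `0` and `(0, L+1)`", "each rhombus in the completion affect[ing]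
  the weight by a factor bounded below by some universal constant `c > 0`" (`YBWalk.extend`,
  `YBWalk.completeRow`, `localWeight_singleton_ge` with `c = sin²(π/8)/2`), and
  `G_{S_T(Θ)}(0, L+1) → 0` since `Σ_L G_{S_T(Θ)}(0, L) = A_{T,Θ} ≤ 1/cos(3π/8) < ∞`
  (`tendsto_twoPoint_cofinite`); similarly for `E`.

Consequently Theorem 1 and Theorem 2 hold as soon as Lemma 2.1, the boundary windings,
`B_T(π/3) → 0` (Prop. 1.1) and Prop. 4.2 do (`GlazmanManolescu2019_thm1_of_lem21`,
`GlazmanManolescu2019_thm2_of_lem21`).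

Also proved here: walks of a finite domain form a finite set (`YBWalk.finite_of_finite`, via
a private copy of `Literature.Probability.Percolation.finite_setOf_nodup_subset`; "since
`Rect_{T,L}(Θ)` is a finite region, the sum in the definition of `F` is finite"); the winding
`YBWalk.winding` as the sum of the rotations `arcTurn` of the arcs ("the arc from `z_W` to `z_N`
… has winding `θ` and the arc from `z_W` to `z_S` has winding `θ − π`"); crude bounds
`u₁, u₂ ≥ sin(π/8)/2`, `v ≥ sin²(π/8)` on `[π/3, 2π/3]`.

Conventions (validated by exhaustive enumeration on small rectangles): sides `W, N, E, S` of the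
rhombus `(k, j)` are `vert k j`, `slant k (j+1)`, `vert (k+1) j`, `slant k j`; a curve crossing a
side at right angles heads along its normal, east through `W`/`E`-sides, at angle `θ_k` through
the slanted sides upwards; the counterclockwise contour of the rhombus gives exactly the printed
relation (CR) with `z_E, z_W, z_S, z_N` the midpoints of `E, W, S, N`.
-/

noncomputable section

open Real Filter Topology
open scoped ENNReal

namespace Literature.Probability.RandomPlanarGeometry.SAW.YangBaxter

open MidEdge

/-! ### Finiteness of the set of walks of a finite domain -/

namespace YBWalk

variable {D : Set Face} {a z : MidEdge}

/-- The mid-edges crossed by a walk of `D` are `a` or sides of faces of `D`. [folklore] -/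
theorem mem_mids_cases (γ : YBWalk D a z) {e : MidEdge} (he : e ∈ γ.mids) :
    e = a ∨ ∃ f ∈ D, ∃ s : Side, f.side s = e := by
  obtain ⟨i, hi, rfl⟩ := List.mem_iff_getElem.1 he
  rcases Nat.eq_zero_or_pos i with rfl | hpos
  · exact Or.inl γ.getElem_zero
  · right
    obtain ⟨j, rfl⟩ : ∃ j, i = j + 1 := ⟨i - 1, by omega⟩
    obtain ⟨f, hfD, hf⟩ := γ.arc_mem _ (γ.mk_mem_arcs (i := j) hi)
    obtain ⟨s, t, -, -, ht, -⟩ := exists_sides_of_arcFace hf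
    exact ⟨f, hfD, t, ht⟩

end YBWalk

/-- The mid-edges available to walks of `D` from `a`: `a` and the sides of faces of `D`. [folklore] -/
def midEdgesOf (D : Set Face) (a : MidEdge) : Set MidEdge := {a} ∪ ⋃ f ∈ D, Set.range f.side

/-- Lists of bounded length with entries in a finite set form a finite set (a private copy of
`Literature.Probability.Percolation.finite_setOf_length_le`, to keep the imports of this line
within the topic). [folklore] -/
private theorem finite_setOf_length_le' {α : Type*} {S : Set α} (hS : S.Finite) (N : ℕ) :
    {l : List α | l.length ≤ N ∧ ∀ x ∈ l, x ∈ S}.Finite := by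
  induction N with
  | zero =>
    refine (Set.finite_singleton ([] : List α)).subset ?_
    rintro l ⟨hl, -⟩
    exact List.eq_nil_of_length_eq_zero (Nat.le_zero.1 hl)
  | succ N ih =>
    have hsub : {l : List α | l.length ≤ N + 1 ∧ ∀ x ∈ l, x ∈ S} ⊆
        {[]} ∪ ⋃ a ∈ S, (fun l => a :: l) '' {l : List α | l.length ≤ N ∧ ∀ x ∈ l, x ∈ S} := by
      rintro l ⟨hl, hmem⟩
      cases l with
      | nil => exact Or.inl rfl
      | cons a l =>
        refine Or.inr (Set.mem_biUnion (hmem a (by simp)) ⟨l, ⟨?_, fun x hx => hmem x (by simp [hx])⟩, rfl⟩)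
        simpa using hl
    exact ((Set.finite_singleton _).union (hS.biUnion fun a _ => (ih.image _))).subset hsub

/-- Self-avoiding lists with entries in a finite set form a finite set (a private copy of
`Literature.Probability.Percolation.finite_setOf_nodup_subset`). [folklore] -/
private theorem finite_setOf_nodup_subset' {α : Type*} {S : Set α} (hS : S.Finite) :
    {l : List α | l.Nodup ∧ ∀ x ∈ l, x ∈ S}.Finite := by
  classical
  refine (finite_setOf_length_le' hS hS.toFinset.card).subset ?_
  rintro l ⟨hnd, hmem⟩
  refine ⟨?_, hmem⟩
  rw [← List.toFinset_card_of_nodup hnd]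
  exact Finset.card_le_card fun x hx => hS.mem_toFinset.2 (hmem x (List.mem_toFinset.1 hx))

/-- Finitely many mid-edges are available in a finite domain. [folklore] -/
theorem midEdgesOf_finite {D : Set Face} (hD : D.Finite) (a : MidEdge) : (midEdgesOf D a).Finite :=
  (Set.finite_singleton a).union (hD.biUnion fun _ _ => Set.finite_range _)

/-- **Walks of a finite domain form a finite set** ("since `Rect_{T,L}(Θ)` is a finite region,
the sum in the definition of `F` is finite"). [cite: GlazmanManolescu2019, §2.1] -/
instance YBWalk.finite_of_finite {D : Set Face} [Finite D] {a z : MidEdge} : Finite (YBWalk D a z) := by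
  have hfin := finite_setOf_nodup_subset' (midEdgesOf_finite (Set.toFinite D) a)
  haveI := hfin.to_subtype
  refine Finite.of_injective (fun γ : YBWalk D a z =>
    (⟨γ.mids, γ.nodup, fun e he => ?_⟩ : {l : List MidEdge | l.Nodup ∧ ∀ x ∈ l, x ∈ midEdgesOf D a}))
    fun γ γ' h => YBWalk.ext (congrArg Subtype.val h)
  rcases γ.mem_mids_cases he with rfl | ⟨f, hfD, s, rfl⟩
  · exact Or.inl rfl
  · exact Or.inr (Set.mem_biUnion hfD ⟨s, rfl⟩)

/-- `Rect_{T,L}` is finite. [cite: GlazmanManolescu2019, §2.1] -/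
theorem rect_finite (T L : ℕ) : (rect T L).Finite := by
  have : rect T L ⊆ (Set.Icc (0 : ℤ) T) ×ˢ (Set.Icc (-(L : ℤ)) L) := by
    rintro ⟨k, j⟩ ⟨h1, h2, h3, h4⟩
    exact ⟨⟨h1, by omega⟩, h3, h4⟩
  exact ((Set.finite_Icc _ _).prod (Set.finite_Icc _ _)).subset this

/-- `Rect_{T,L}` is a finite type of faces. [cite: GlazmanManolescu2019, §2.1] -/
instance (T L : ℕ) : Finite (rect T L) := (rect_finite T L).to_subtype

/-- Walks of `Rect_{T,L}` form a finite type (noncomputably enumerated), so that the observable is a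
finite sum. [cite: GlazmanManolescu2019, §2.1 ("the sum in the definition of F is finite")] -/
noncomputable instance (T L : ℕ) (a z : MidEdge) : Fintype (YBWalk (rect T L) a z) := Fintype.ofFinite _

/-! ### Crude positive lower bounds on `u₁, u₂, v` -/

section Bounds

variable {θ : ℝ}

/-- The positive denominator `P = sin(π/4 + 3θ/8) sin(5π/8 − 3θ/8) ∈ (0, 1]`. [folklore] -/
theorem den'_pos_le_one (hθ : θ ∈ Set.Icc (π / 3) (2 * π / 3)) :
    0 < sin (π / 4 + 3 * θ / 8) * sin (5 * π / 8 - 3 * θ / 8) ∧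
      sin (π / 4 + 3 * θ / 8) * sin (5 * π / 8 - 3 * θ / 8) ≤ 1 := by
  obtain ⟨h1, h2⟩ := three_mul_div_eight_mem hθ
  have hpi := Real.pi_pos
  have ha : 0 < sin (π / 4 + 3 * θ / 8) := sin_pos_of_pos_of_lt_pi (by linarith) (by linarith)
  have hb : 0 < sin (5 * π / 8 - 3 * θ / 8) := sin_pos_of_pos_of_lt_pi (by linarith) (by linarith)
  exact ⟨mul_pos ha hb, mul_le_one₀ (sin_le_one _) hb.le (sin_le_one _)⟩

/-- `sin(π/8) ≤ sin(5π/8 + 3θ/8)` on `[π/3, 2π/3]`. [folklore] -/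
theorem sin_pi_div_eight_le_sin_add (hθ : θ ∈ Set.Icc (π / 3) (2 * π / 3)) :
    sin (π / 8) ≤ sin (5 * π / 8 + 3 * θ / 8) := by
  obtain ⟨h1, h2⟩ := three_mul_div_eight_mem hθ
  have hpi := Real.pi_pos
  rw [← sin_pi_sub (5 * π / 8 + 3 * θ / 8)]
  exact sin_le_sin_of_le_of_le_pi_div_two (by linarith) (by linarith) (by linarith)

/-- `sin(π/8) ≤ sin(3θ/8)` on `[π/3, 2π/3]`. [folklore] -/
theorem sin_pi_div_eight_le_sin (hθ : θ ∈ Set.Icc (π / 3) (2 * π / 3)) : sin (π / 8) ≤ sin (3 * θ / 8) := by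
  obtain ⟨h1, h2⟩ := three_mul_div_eight_mem hθ
  have hpi := Real.pi_pos
  exact sin_le_sin_of_le_of_le_pi_div_two (by linarith) (by linarith) h1

/-- `u₁ ≥ sin(π/8)/2` on `[π/3, 2π/3]`. [folklore] -/
theorem weightU1_ge (hθ : θ ∈ Set.Icc (π / 3) (2 * π / 3)) : sin (π / 8) / 2 ≤ weightU1 θ := by
  obtain ⟨hP, hP1⟩ := den'_pos_le_one hθ
  have hN := sin_pi_div_eight_le_sin_add hθ
  have h8 := sin_pi_div_eight_pos
  have hs2 : (1 : ℝ) ≤ Real.sqrt 2 := Real.one_le_sqrt.2 (by norm_num)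
  rw [weightU1, weightDen, sin_five_pi_div_four_add, neg_mul, div_neg, show (5 * π / 4 : ℝ) = π / 4 + π by ring,
    sin_add_pi, sin_pi_div_four, neg_mul, neg_div, neg_neg, le_div_iff₀ hP]
  nlinarith [mul_le_mul_of_nonneg_left hP1 h8.le]

/-- `u₂ ≥ sin(π/8)/2` on `[π/3, 2π/3]`. [folklore] -/
theorem weightU2_ge (hθ : θ ∈ Set.Icc (π / 3) (2 * π / 3)) : sin (π / 8) / 2 ≤ weightU2 θ := by
  obtain ⟨hP, hP1⟩ := den'_pos_le_one hθ
  have hN := sin_pi_div_eight_le_sin hθ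
  have h8 := sin_pi_div_eight_pos
  have hs2 : (1 : ℝ) ≤ Real.sqrt 2 := Real.one_le_sqrt.2 (by norm_num)
  rw [weightU2, weightDen, sin_five_pi_div_four_add, neg_mul, div_neg, show (5 * π / 4 : ℝ) = π / 4 + π by ring,
    sin_add_pi, sin_pi_div_four, neg_mul, neg_div, neg_neg, le_div_iff₀ hP]
  nlinarith [mul_le_mul_of_nonneg_left hP1 h8.le]

/-- `v ≥ sin²(π/8)` on `[π/3, 2π/3]`. [folklore] -/
theorem weightV_ge (hθ : θ ∈ Set.Icc (π / 3) (2 * π / 3)) : sin (π / 8) ^ 2 ≤ weightV θ := by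
  obtain ⟨hP, hP1⟩ := den'_pos_le_one hθ
  have hN := sin_pi_div_eight_le_sin_add hθ
  have hN' := sin_pi_div_eight_le_sin hθ
  have h8 := sin_pi_div_eight_pos
  rw [weightV, weightDen, sin_five_pi_div_four_add, neg_mul, div_neg, sin_neg, mul_neg, neg_div, neg_neg,
    le_div_iff₀ hP]
  nlinarith [mul_le_mul_of_nonneg_left hP1 (sq_nonneg (sin (π / 8))), mul_le_mul hN hN' h8.le (h8.le.trans hN),
    sq_nonneg (sin (π / 8))]

/-- **A universal lower bound on the weight of a single arc**: `sin²(π/8)/2 ≤ u₁, u₂, v`.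
[cite: GlazmanManolescu2019, proof of Corollary 2.3 ("a factor bounded below by some universal constant c > 0")] -/
theorem localWeight_singleton_ge (hθ : θ ∈ Set.Icc (π / 3) (2 * π / 3)) {s t : Side} (hst : s ≠ t) :
    sin (π / 8) ^ 2 / 2 ≤ localWeight θ [arcKind s t] := by
  have h8 := sin_pi_div_eight_pos
  have h1 : sin (π / 8) ≤ 1 := sin_le_one _
  have hu1 : sin (π / 8) ^ 2 / 2 ≤ weightU1 θ := le_trans (by nlinarith) (weightU1_ge hθ)
  have hu2 : sin (π / 8) ^ 2 / 2 ≤ weightU2 θ := le_trans (by nlinarith) (weightU2_ge hθ)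
  have hv : sin (π / 8) ^ 2 / 2 ≤ weightV θ := le_trans (by nlinarith) (weightV_ge hθ)
  cases s <;> cases t <;> first | exact absurd rfl hst | (simp only [arcKind, localWeight]; assumption)

/-- The universal constant is in `(0, 1]`. [folklore] -/
theorem sin_sq_div_two_pos_le_one : 0 < sin (π / 8) ^ 2 / 2 ∧ sin (π / 8) ^ 2 / 2 ≤ 1 := by
  have h8 := sin_pi_div_eight_pos
  have h1 : sin (π / 8) ≤ 1 := sin_le_one _
  constructor <;> nlinarith

end Bounds

/-! ### Arcs of concatenated lists -/

/-- No arc in the empty list. [folklore] -/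
@[simp] theorem arcsOf_nil : arcsOf [] = [] := rfl

/-- No arc through a single mid-edge. [folklore] -/
@[simp] theorem arcsOf_singleton (x : MidEdge) : arcsOf [x] = [] := rfl

/-- The first arc of a list. [folklore] -/
@[simp] theorem arcsOf_cons_cons (x y : MidEdge) (l : List MidEdge) :
    arcsOf (x :: y :: l) = (x, y) :: arcsOf (y :: l) := rfl

/-- The arcs of a concatenation `l ++ [x] ++ ext`. [folklore] -/
theorem arcsOf_append_cons (l : List MidEdge) (x : MidEdge) (ext : List MidEdge) :
    arcsOf (l ++ x :: ext) = arcsOf (l ++ [x]) ++ arcsOf (x :: ext) := by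
  induction l with
  | nil => simp
  | cons y l ih =>
    cases l with
    | nil => rfl
    | cons y' l =>
      simp only [List.cons_append] at ih ⊢
      rw [arcsOf_cons_cons, arcsOf_cons_cons, ih]; rfl

/-- Opposite sides of a face have that face as their common face. [folklore] -/
theorem arcFace_side_W_E (f : Face) : arcFace (f.side .W, f.side .E) = some f := by
  obtain ⟨k, j⟩ := f
  simp [arcFace, commonFace, Face.side, faces]; omega

/-- Opposite sides of a face have that face as their common face. [folklore] -/
theorem arcFace_side_E_W (f : Face) : arcFace (f.side .E, f.side .W) = some f := by
  obtain ⟨k, j⟩ := f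
  simp [arcFace, commonFace, Face.side, faces]

/-- Opposite sides of a face have that face as their common face. [folklore] -/
theorem arcFace_side_S_N (f : Face) : arcFace (f.side .S, f.side .N) = some f := by
  obtain ⟨k, j⟩ := f
  simp [arcFace, commonFace, Face.side, faces]; omega

/-- Opposite sides of a face have that face as their common face. [folklore] -/
theorem arcFace_side_N_S (f : Face) : arcFace (f.side .N, f.side .S) = some f := by
  obtain ⟨k, j⟩ := f
  simp [arcFace, commonFace, Face.side, faces]

namespace YBWalk

variable {D D' : Set Face} {a z : MidEdge}

/-- The mid-edges of a walk split as `… ++ [z]`. [folklore] -/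
theorem mids_eq_dropLast_append (γ : YBWalk D a z) : γ.mids = γ.mids.dropLast ++ [z] := by
  conv_lhs => rw [← List.dropLast_append_getLast γ.mids_ne_nil]
  congr 2
  rw [List.getLast_eq_getElem]
  exact γ.getElem_length_sub_one

/-- **Extension of a walk by a path through fresh rhombi.** Appending to a walk `γ : a → z` of
`D` a list `ext` of new mid-edges such that the consecutive pairs of `z :: ext` are arcs drawn
in pairwise distinct faces of `D' ⊇ D` not visited by `γ` gives a walk of `D'` ("any
self-avoiding path … may be completed by at most `T` steps … to form a self-avoiding path on
`Strip_T(Θ)`"). [cite: GlazmanManolescu2019, proof of Corollary 2.3] -/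
def extend (γ : YBWalk D a z) (hD : D ⊆ D') (ext : List MidEdge) (z' : MidEdge)
    (hne : ext ≠ []) (hlast : ext.getLast hne = z') (hnodup : ext.Nodup)
    (hdisj : ∀ e ∈ ext, e ∉ γ.mids)
    (hfaces : ∀ p ∈ arcsOf (z :: ext), ∃ f ∈ D', arcFace p = some f ∧ f ∉ γ.facesVisited)
    (hdistinct : ((arcsOf (z :: ext)).map arcFace).Nodup) : YBWalk D' a z' where
  mids := γ.mids ++ ext
  head_eq := by rw [List.head?_append, γ.head_eq]; rfl
  getLast_eq := by rw [List.getLast?_append, List.getLast?_eq_some_getLast hne, hlast]; rfl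
  nodup := List.nodup_append.2 ⟨γ.nodup, hnodup, fun e he e' he' h => hdisj e' he' (h ▸ he)⟩
  arc_mem p hp := by
    rw [γ.mids_eq_dropLast_append, List.append_assoc, List.singleton_append, arcsOf_append_cons,
      ← γ.mids_eq_dropLast_append, List.mem_append] at hp
    rcases hp with hp | hp
    · obtain ⟨f, hf, hpf⟩ := γ.arc_mem p hp
      exact ⟨f, hD hf, hpf⟩
    · obtain ⟨f, hf, hpf, -⟩ := hfaces p hp
      exact ⟨f, hf, hpf⟩
  isChain := by
    rw [γ.mids_eq_dropLast_append, List.append_assoc, List.singleton_append, arcsOf_append_cons,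
      ← γ.mids_eq_dropLast_append]
    refine List.isChain_append.2 ⟨γ.isChain, ?_, ?_⟩
    · have : (List.map arcFace (arcsOf (z :: ext))).IsChain (· ≠ ·) := hdistinct.isChain
      exact (List.isChain_map _).1 this
    · intro p hp q hq h
      obtain ⟨f, hf, hpf⟩ := γ.arc_mem p (List.mem_of_mem_getLast? hp)
      obtain ⟨f', -, hqf, hfresh⟩ := hfaces q (List.mem_of_mem_head? hq)
      rw [hpf, hqf, Option.some.injEq] at h
      exact hfresh (h ▸ γ.mem_facesVisited_of_arcFace (List.mem_of_mem_getLast? hp) hpf)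
  noncross f := by
    rw [γ.mids_eq_dropLast_append, List.append_assoc, List.singleton_append, arcsOf_append_cons,
      ← γ.mids_eq_dropLast_append]
    simp only [List.mem_append]
    -- an arc with face `f` is old iff `f` is visited by `γ`
    have old_iff : ∀ p, arcFace p = some f → (p ∈ γ.arcs ∨ p ∈ arcsOf (z :: ext)) →
        (p ∈ γ.arcs ↔ f ∈ γ.facesVisited) := by
      intro p hpf hp
      constructor
      · intro h; exact γ.mem_facesVisited_of_arcFace h hpf
      · intro hf
        rcases hp with hp | hp
        · exact hp
        · obtain ⟨f', -, hpf', hfresh⟩ := hfaces p hp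
          rw [hpf, Option.some.injEq] at hpf'
          exact absurd (hpf' ▸ hf) hfresh
    have hinj := List.inj_on_of_nodup_map hdistinct
    intro hWE hSN
    by_cases hf : f ∈ γ.facesVisited
    · -- all four candidate arcs, if present, are old
      have hold : ∀ p, arcFace p = some f → (p ∈ γ.arcs ∨ p ∈ arcsOf (z :: ext)) → p ∈ γ.arcs :=
        fun p hpf hp => (old_iff p hpf hp).2 hf
      apply γ.noncross f
      · rcases hWE with h | h
        · exact Or.inl (hold _ (arcFace_side_W_E f) h)
        · exact Or.inr (hold _ (arcFace_side_E_W f) h)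
      · rcases hSN with h | h
        · exact Or.inl (hold _ (arcFace_side_S_N f) h)
        · exact Or.inr (hold _ (arcFace_side_N_S f) h)
    · -- all are new, hence two distinct new arcs share the face `f`
      have hnew : ∀ p, arcFace p = some f → (p ∈ γ.arcs ∨ p ∈ arcsOf (z :: ext)) → p ∈ arcsOf (z :: ext) := by
        intro p hpf hp
        rcases hp with hp | hp
        · exact absurd (γ.mem_facesVisited_of_arcFace hp hpf) hf
        · exact hp
      have key : ∀ p q, arcFace p = some f → arcFace q = some f →
          (p ∈ γ.arcs ∨ p ∈ arcsOf (z :: ext)) → (q ∈ γ.arcs ∨ q ∈ arcsOf (z :: ext)) → p = q :=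
        fun p q hpf hqf hp hq => hinj (hnew p hpf hp) (hnew q hqf hq) (hpf.trans hqf.symm)
      have hsides : Function.Injective f.side := by
        intro s t h
        obtain ⟨k, j⟩ := f
        cases s <;> cases t <;> simp [Face.side] at h ⊢
      rcases hWE with h | h <;> rcases hSN with h' | h'
      · have := key _ _ (arcFace_side_W_E f) (arcFace_side_S_N f) h h'
        simp only [Prod.mk.injEq] at this; exact absurd (hsides this.1) (by decide)
      · have := key _ _ (arcFace_side_W_E f) (arcFace_side_N_S f) h h'
        simp only [Prod.mk.injEq] at this; exact absurd (hsides this.1) (by decide)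
      · have := key _ _ (arcFace_side_E_W f) (arcFace_side_S_N f) h h'
        simp only [Prod.mk.injEq] at this; exact absurd (hsides this.1) (by decide)
      · have := key _ _ (arcFace_side_E_W f) (arcFace_side_N_S f) h h'
        simp only [Prod.mk.injEq] at this; exact absurd (hsides this.1) (by decide)

section extend

variable (γ : YBWalk D a z) (hD : D ⊆ D') (ext : List MidEdge) (z' : MidEdge)
    (hne : ext ≠ []) (hlast : ext.getLast hne = z') (hnodup : ext.Nodup)
    (hdisj : ∀ e ∈ ext, e ∉ γ.mids)
    (hfaces : ∀ p ∈ arcsOf (z :: ext), ∃ f ∈ D', arcFace p = some f ∧ f ∉ γ.facesVisited)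
    (hdistinct : ((arcsOf (z :: ext)).map arcFace).Nodup)

/-- The mid-edges of an extension. [folklore] -/
@[simp] theorem mids_extend :
    (γ.extend hD ext z' hne hlast hnodup hdisj hfaces hdistinct).mids = γ.mids ++ ext := rfl

/-- The arcs of an extension: the old ones followed by the new ones. [folklore] -/
theorem arcs_extend :
    (γ.extend hD ext z' hne hlast hnodup hdisj hfaces hdistinct).arcs = γ.arcs ++ arcsOf (z :: ext) := by
  show arcsOf (γ.mids ++ ext) = _
  rw [γ.mids_eq_dropLast_append, List.append_assoc, List.singleton_append, arcsOf_append_cons,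
    ← γ.mids_eq_dropLast_append]

/-- The new faces of an extension. [folklore] -/
def newFaces : Finset Face := ((arcsOf (z :: ext)).filterMap arcFace).toFinset

/-- The faces visited by an extension. [folklore] -/
theorem facesVisited_extend :
    (γ.extend hD ext z' hne hlast hnodup hdisj hfaces hdistinct).facesVisited =
      γ.facesVisited ∪ newFaces ext (z := z) := by
  unfold facesVisited newFaces
  rw [arcs_extend, List.filterMap_append, List.toFinset_append]

include hfaces in
/-- The new faces are not visited by the original walk. [folklore] -/
theorem disjoint_newFaces : Disjoint γ.facesVisited (newFaces ext (z := z)) := by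
  rw [Finset.disjoint_right]
  intro f hf
  simp only [newFaces, List.mem_toFinset, List.mem_filterMap] at hf
  obtain ⟨p, hp, hpf⟩ := hf
  obtain ⟨f', -, hpf', hfresh⟩ := hfaces p hp
  rw [hpf, Option.some.injEq] at hpf'
  exact hpf' ▸ hfresh

/-- In a face visited by the original walk, the extension has the same arcs. [folklore] -/
theorem kindsIn_extend_of_mem {f : Face} (hf : f ∈ γ.facesVisited) :
    (γ.extend hD ext z' hne hlast hnodup hdisj hfaces hdistinct).kindsIn f = γ.kindsIn f := by
  unfold kindsIn
  rw [arcs_extend, List.filterMap_append]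
  convert List.append_nil _
  rw [List.filterMap_eq_nil_iff]
  intro p hp
  rw [if_neg]
  intro hpf
  obtain ⟨f', -, hpf', hfresh⟩ := hfaces p hp
  rw [hpf, Option.some.injEq] at hpf'
  exact hfresh (hpf' ▸ hf)

/-- In a new face, the extension has exactly the one new arc drawn in it. [folklore] -/
theorem kindsIn_extend_of_new {f : Face} {p : MidEdge × MidEdge} (hp : p ∈ arcsOf (z :: ext))
    (hpf : arcFace p = some f) {κ : ArcKind} (hκ : arcKindOf p = some κ) :
    (γ.extend hD ext z' hne hlast hnodup hdisj hfaces hdistinct).kindsIn f = [κ] := by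
  refine kindsIn_eq_singleton _ (by rw [arcs_extend]; exact List.mem_append_right _ hp) hpf ?_ hκ
  intro q hq hqf
  rw [arcs_extend, List.mem_append] at hq
  rcases hq with hq | hq
  · obtain ⟨f', -, -, hfresh⟩ := hfaces p hp
    obtain ⟨f'', -, hpf'', hfresh''⟩ := hfaces p hp
    rw [hpf, Option.some.injEq] at hpf''
    exact absurd (γ.mem_facesVisited_of_arcFace hq hqf) (hpf'' ▸ hfresh'')
  · exact List.inj_on_of_nodup_map hdistinct hq hp (hqf.trans hpf.symm)

/-- **Weight of an extension**: the old weight times local weights `≥ m` of the at most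
`ext.length` new rhombi, each crossed by a single arc. [cite: GlazmanManolescu2019, proof of
Corollary 2.3 ("Each rhombus in the completion affects the weight of γ by a factor bounded below by some universal constant c > 0")] -/
theorem weight_extend_ge {Θ : ℤ → ℝ} (hΘ : ∀ k, Θ k ∈ Set.Icc (π / 3) (2 * π / 3)) {m : ℝ}
    (hm0 : 0 ≤ m) (hm1 : m ≤ 1)
    (hm : ∀ (θ : ℝ), θ ∈ Set.Icc (π / 3) (2 * π / 3) → ∀ s t : Side, s ≠ t → m ≤ localWeight θ [arcKind s t]) :
    γ.weight Θ * m ^ ext.length ≤ (γ.extend hD ext z' hne hlast hnodup hdisj hfaces hdistinct).weight Θ := by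
  have hw := γ.weight_nonneg hΘ
  have hold : ∏ f ∈ γ.facesVisited, localWeight (Θ f.1)
      ((γ.extend hD ext z' hne hlast hnodup hdisj hfaces hdistinct).kindsIn f) = γ.weight Θ :=
    Finset.prod_congr rfl fun f hf => by
      rw [γ.kindsIn_extend_of_mem hD ext z' hne hlast hnodup hdisj hfaces hdistinct hf]
  conv_rhs => rw [weight, facesVisited_extend, Finset.prod_union (γ.disjoint_newFaces ext hfaces), hold]
  refine mul_le_mul_of_nonneg_left ?_ hw
  -- each new face contributes at least `m`, and there are at most `ext.length` of them
  have hcard : (newFaces ext (z := z)).card ≤ ext.length := by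
    refine (List.toFinset_card_le _).trans ((List.length_filterMap_le _ _).trans ?_)
    simp [arcsOf, List.length_zip]
  calc m ^ ext.length ≤ m ^ (newFaces ext (z := z)).card := pow_le_pow_of_le_one hm0 hm1 hcard
    _ = ∏ _f ∈ newFaces ext (z := z), m := by rw [Finset.prod_const]
    _ ≤ _ := by
      refine Finset.prod_le_prod (fun _ _ => hm0) fun f hf => ?_
      simp only [newFaces, List.mem_toFinset, List.mem_filterMap] at hf
      obtain ⟨p, hp, hpf⟩ := hf
      obtain ⟨s, t, hst, -, -, hk⟩ := exists_sides_of_arcFace hpf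
      rw [γ.kindsIn_extend_of_new hD ext z' hne hlast hnodup hdisj hfaces hdistinct hp hpf hk]
      obtain ⟨f', hf'D, hpf', -⟩ := hfaces p hp
      exact hm _ (hΘ f.1) s t hst

end extend

end YBWalk

/-! ### Completing a walk of the rectangle along the row above or below it -/

/-- The mid-edges `vert k r, vert (k-1) r, …, vert 0 r` of row `r`, from column `k` to the boundary.
[cite: GlazmanManolescu2019, proof of Corollary 2.3] -/
def extRow : ℕ → ℤ → List MidEdge
  | 0, r => [.vert 0 r]
  | k + 1, r => .vert ((k : ℤ) + 1) r :: extRow k r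

/-- `extRow` is nonempty. [folklore] -/
theorem extRow_ne_nil (k : ℕ) (r : ℤ) : extRow k r ≠ [] := by cases k <;> simp [extRow]

/-- `extRow` starts at column `k`. [folklore] -/
theorem extRow_eq_cons (k : ℕ) (r : ℤ) : ∃ t, extRow k r = .vert k r :: t := by
  cases k with
  | zero => exact ⟨[], rfl⟩
  | succ k => exact ⟨extRow k r, by simp [extRow]⟩

/-- `extRow` ends on the boundary. [folklore] -/
theorem getLast_extRow (k : ℕ) (r : ℤ) : (extRow k r).getLast (extRow_ne_nil k r) = .vert 0 r := by
  induction k with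
  | zero => rfl
  | succ k ih => rw [← ih]; simp only [extRow]; rw [List.getLast_cons (extRow_ne_nil k r)]

/-- The members of `extRow`. [folklore] -/
theorem mem_extRow {k : ℕ} {r : ℤ} {e : MidEdge} (he : e ∈ extRow k r) : ∃ c : ℕ, c ≤ k ∧ e = .vert c r := by
  induction k with
  | zero => simp only [extRow, List.mem_singleton] at he; exact ⟨0, le_rfl, he⟩
  | succ k ih =>
    simp only [extRow, List.mem_cons] at he
    rcases he with rfl | he
    · exact ⟨k + 1, le_rfl, by push_cast; rfl⟩
    · obtain ⟨c, hc, rfl⟩ := ih he; exact ⟨c, by omega, rfl⟩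

/-- `extRow` has no repetition. [folklore] -/
theorem nodup_extRow (k : ℕ) (r : ℤ) : (extRow k r).Nodup := by
  induction k with
  | zero => simp [extRow]
  | succ k ih =>
    simp only [extRow, List.nodup_cons]
    refine ⟨fun h => ?_, ih⟩
    obtain ⟨c, hc, h⟩ := mem_extRow h
    simp only [MidEdge.vert.injEq] at h; omega

/-- `extRow k r` has `k + 1` members. [folklore] -/
theorem length_extRow (k : ℕ) (r : ℤ) : (extRow k r).length = k + 1 := by
  induction k with
  | zero => rfl
  | succ k ih => simp [extRow, ih]

/-- The arcs of `x :: extRow k r`. [folklore] -/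
theorem arcsOf_cons_extRow (x : MidEdge) (k : ℕ) (r : ℤ) :
    arcsOf (x :: extRow k r) = (x, .vert k r) :: arcsOf (extRow k r) := by
  cases k with
  | zero => rfl
  | succ k => simp [extRow]

/-- The face of a westward arc. [folklore] -/
theorem arcFace_vert_succ_vert (c r : ℤ) : arcFace (MidEdge.vert (c + 1) r, MidEdge.vert c r) = some (c, r) := by
  simp [arcFace, commonFace, faces]

/-- The faces of the arcs of `extRow`: `(k-1, r), …, (0, r)`. [folklore] -/
theorem map_arcFace_arcsOf_extRow (k : ℕ) (r : ℤ) :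
    (arcsOf (extRow k r)).map arcFace = ((List.range k).map fun c : ℕ => some ((c : ℤ), r)).reverse := by
  induction k with
  | zero => rfl
  | succ k ih =>
    rw [show extRow (k + 1) r = .vert ((k : ℤ) + 1) r :: extRow k r from rfl, arcsOf_cons_extRow,
      List.map_cons, ih, arcFace_vert_succ_vert, List.range_succ, List.map_append, List.reverse_append]
    rfl

namespace YBWalk

variable {T L : ℕ} {z : MidEdge}

/-- Mid-edges of a walk of `Rect_{T,L}` from `0` that are vertical lie in rows `−L, …, L`. [folklore] -/
theorem vert_row_le (γ : YBWalk (rect T L) origin z) {c j : ℤ} (h : MidEdge.vert c j ∈ γ.mids) :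
    -(L : ℤ) ≤ j ∧ j ≤ L := by
  rcases γ.mem_mids_cases h with h | ⟨f, hf, s, hs⟩
  · simp only [origin, MidEdge.vert.injEq] at h; omega
  · obtain ⟨-, -, h3, h4⟩ := hf
    cases s <;> simp only [Face.side, MidEdge.vert.injEq, reduceCtorEq] at hs <;> omega

/-- **Completion of a walk to the top or bottom side along the next row** (`r = L + 1` from
`slant k (L+1)`, or `r = −L − 1` from `slant k (−L)`): a walk of `Strip_T` ending on the left
boundary. [cite: GlazmanManolescu2019, proof of Corollary 2.3] -/
def completeRow (γ : YBWalk (rect T L) origin z) (k : ℕ) (hk : k < T) (r : ℤ) (hr : (L : ℤ) < r ∨ r < -(L : ℤ))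
    (hz : arcFace (z, .vert k r) = some ((k : ℤ), r)) : YBWalk (strip T) origin (.vert 0 r) :=
  γ.extend (rect_subset_strip T L) (extRow k r) _ (extRow_ne_nil k r) (getLast_extRow k r) (nodup_extRow k r)
    (fun e he hem => by
      obtain ⟨c, -, rfl⟩ := mem_extRow he
      have := γ.vert_row_le hem; omega)
    (fun p hp => by
      have hmem : arcFace p ∈ (arcsOf (z :: extRow k r)).map arcFace := List.mem_map_of_mem hp
      rw [arcsOf_cons_extRow, List.map_cons, hz, map_arcFace_arcsOf_extRow, List.mem_cons, List.mem_reverse,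
        List.mem_map] at hmem
      obtain ⟨c, hck, hc⟩ : ∃ c : ℕ, c ≤ k ∧ arcFace p = some ((c : ℤ), r) := by
        rcases hmem with h | ⟨c, hc, h⟩
        · exact ⟨k, le_rfl, h⟩
        · exact ⟨c, (List.mem_range.1 hc).le, h.symm⟩
      refine ⟨((c : ℤ), r), ⟨by simp, by simp; omega⟩, hc, fun hf => ?_⟩
      have := γ.mem_of_mem_facesVisited hf
      obtain ⟨-, -, h3, h4⟩ := this
      simp only at h3 h4; omega)
    (by
      rw [arcsOf_cons_extRow, List.map_cons, hz, map_arcFace_arcsOf_extRow, List.nodup_cons]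
      refine ⟨fun h => ?_, (List.nodup_reverse.2 ((List.nodup_range).map fun c c' h => by simpa using h))⟩
      rw [List.mem_reverse, List.mem_map] at h
      obtain ⟨c, hc, h⟩ := h
      simp only [Option.some.injEq, Prod.mk.injEq, and_true, Nat.cast_inj] at h
      rw [List.mem_range] at hc; omega)

/-- The completion appends `extRow`. [folklore] -/
@[simp] theorem mids_completeRow (γ : YBWalk (rect T L) origin z) (k : ℕ) (hk : k < T) (r : ℤ)
    (hr : (L : ℤ) < r ∨ r < -(L : ℤ)) (hz : arcFace (z, .vert k r) = some ((k : ℤ), r)) :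
    (γ.completeRow k hk r hr hz).mids = γ.mids ++ extRow k r := rfl

/-- Completion is injective. [cite: GlazmanManolescu2019, proof of Corollary 2.3] -/
theorem completeRow_injective (k : ℕ) (hk : k < T) (r : ℤ) (hr : (L : ℤ) < r ∨ r < -(L : ℤ))
    (hz : arcFace (z, .vert k r) = some ((k : ℤ), r)) :
    Function.Injective fun γ : YBWalk (rect T L) origin z => γ.completeRow k hk r hr hz := by
  intro γ γ' h
  have := congrArg YBWalk.mids h
  simp only [mids_completeRow, List.append_cancel_right_eq] at this
  exact YBWalk.ext this

/-- **The completion costs at most a factor `m^T`**. [cite: GlazmanManolescu2019, proof of Corollary 2.3] -/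
theorem weight_completeRow_ge (γ : YBWalk (rect T L) origin z) (k : ℕ) (hk : k < T) (r : ℤ)
    (hr : (L : ℤ) < r ∨ r < -(L : ℤ)) (hz : arcFace (z, .vert k r) = some ((k : ℤ), r))
    {Θ : ℤ → ℝ} (hΘ : ∀ k, Θ k ∈ Set.Icc (π / 3) (2 * π / 3)) {m : ℝ} (hm0 : 0 ≤ m) (hm1 : m ≤ 1)
    (hm : ∀ (θ : ℝ), θ ∈ Set.Icc (π / 3) (2 * π / 3) → ∀ s t : Side, s ≠ t → m ≤ localWeight θ [arcKind s t]) :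
    γ.weight Θ * m ^ T ≤ (γ.completeRow k hk r hr hz).weight Θ := by
  refine le_trans ?_ (γ.weight_extend_ge _ _ _ _ _ _ _ _ _ hΘ hm0 hm1 hm)
  rw [length_extRow]
  exact mul_le_mul_of_nonneg_left (pow_le_pow_of_le_one hm0 hm1 (by omega)) (γ.weight_nonneg hΘ)

end YBWalk

/-- The face of the first completion arc above the rectangle. [folklore] -/
theorem arcFace_slant_vert_top (k r : ℤ) : arcFace (MidEdge.slant k r, MidEdge.vert k r) = some (k, r) := by
  simp [arcFace, commonFace, faces]

/-- The face of the first completion arc below the rectangle. [folklore] -/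
theorem arcFace_slant_vert_bottom (k r : ℤ) : arcFace (MidEdge.slant k (r + 1), MidEdge.vert k r) = some (k, r) := by
  simp [arcFace, commonFace, faces]

/-! ### The winding of a walk -/

/-- **The rotation of an arc** inside a rhombus of upper-left angle `θ`, from the side `s` it
enters through to the side `t` it leaves through (the curve crosses sides at right angles):
`+θ` at the `θ`-corners turned counterclockwise (`W→N`, `E→S`), `−θ` clockwise (`N→W`,
`S→E`); `θ − π` / `π − θ` at the `(π−θ)`-corners (`W→S`, `E→N` / `S→W`, `N→E`); `0` for
straight arcs ("the arc from `z_W` to `z_N` … has winding `θ` and the arc from `z_W` to `z_S`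
has winding `θ − π`"). [cite: GlazmanManolescu2019, §2.1 (definition of wind(γ))] -/
def arcTurn (θ : ℝ) : Side → Side → ℝ
  | .W, .N => θ
  | .N, .W => -θ
  | .S, .E => -θ
  | .E, .S => θ
  | .W, .S => θ - π
  | .S, .W => π - θ
  | .N, .E => π - θ
  | .E, .N => θ - π
  | _, _ => 0

/-- The rotation of the arc `p` (drawn in its face, of angle `Θ k` in column `k`).
[cite: GlazmanManolescu2019, §2.1] -/
def arcTurnOf (Θ : ℤ → ℝ) (p : MidEdge × MidEdge) : ℝ :=
  match arcFace p with
  | some f =>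
    match f.sideOf p.1, f.sideOf p.2 with
    | some s, some t => arcTurn (Θ f.1) s t
    | _, _ => 0
  | none => 0

namespace YBWalk

variable {D : Set Face} {a z : MidEdge}

/-- **The winding `wind(γ)`** of a walk: "the total angle of rotation of `γ` going from `0` to
`z`", the sum of the rotations of its arcs. [cite: GlazmanManolescu2019, §2.1, eq. (2.1)] -/
def winding (Θ : ℤ → ℝ) (γ : YBWalk D a z) : ℝ := (γ.arcs.map (arcTurnOf Θ)).sum

/-- The empty walk does not turn. [cite: GlazmanManolescu2019, §2.1] -/
@[simp] theorem winding_trivial (Θ : ℤ → ℝ) (a : MidEdge) : (trivial a : YBWalk D a a).winding Θ = 0 := by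
  simp [winding]

/-- The parafermionic weight `w(γ) e^{-i σ wind(γ)}`, `σ = 5/8`. [cite: GlazmanManolescu2019, eq. (2.1)] -/
def paraWeight (Θ : ℤ → ℝ) (γ : YBWalk D a z) : ℂ :=
  (γ.weight Θ : ℂ) * Complex.exp ((-(5 / 8 * γ.winding Θ) : ℝ) * Complex.I)

/-- The empty walk has parafermionic weight `1`. [cite: GlazmanManolescu2019, Lemma 2.2 ("the empty configuration")] -/
@[simp] theorem paraWeight_trivial (Θ : ℤ → ℝ) (a : MidEdge) : (trivial a : YBWalk D a a).paraWeight Θ = 1 := by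
  simp [paraWeight]

/-- `Re[w e^{-iσW}] = w cos(σW)`. [folklore] -/
theorem paraWeight_re (Θ : ℤ → ℝ) (γ : YBWalk D a z) :
    (γ.paraWeight Θ).re = γ.weight Θ * Real.cos (5 / 8 * γ.winding Θ) := by
  rw [paraWeight, Complex.re_ofReal_mul, Complex.exp_ofReal_mul_I_re, Real.cos_neg]

end YBWalk

/-! ### The parafermionic observable in the rectangle and the boundary sums -/

/-- **The parafermionic observable** `F(z) = Σ_{γ ⊂ Rect_{T,L}(Θ) : 0 → z} w(γ) e^{-i·(5/8)·wind(γ)}`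
(a finite sum). [cite: GlazmanManolescu2019, §2.1, eq. (2.1)] -/
def parafermion (T L : ℕ) (Θ : ℤ → ℝ) (z : MidEdge) : ℂ :=
  ∑ γ : YBWalk (rect T L) origin z, γ.paraWeight Θ

/-- `G_{Rect_{T,L}(Θ)}(0, z)` as a real finite sum. [cite: GlazmanManolescu2019, §2.1] -/
def rectTwoPoint (T L : ℕ) (Θ : ℤ → ℝ) (z : MidEdge) : ℝ :=
  ∑ γ : YBWalk (rect T L) origin z, γ.weight Θ

/-- **`A_{T,L,Θ}`**: walks of `Rect_{T,L}(Θ)` from `0` to a point of its left side `α` (rows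
`−L, …, L` of the boundary of `H`), the empty walk excluded. [cite: GlazmanManolescu2019, eq. (2.2)] -/
def rectA (T L : ℕ) (Θ : ℤ → ℝ) : ℝ :=
  ∑ j ∈ Finset.Icc (-(L : ℤ)) L, if j = 0 then 0 else rectTwoPoint T L Θ (.vert 0 j)

/-- **`B_{T,L,Θ}`**: walks of `Rect_{T,L}(Θ)` from `0` to a point of its right side `β`.
[cite: GlazmanManolescu2019, eq. (2.2)] -/
def rectB (T L : ℕ) (Θ : ℤ → ℝ) : ℝ :=
  ∑ j ∈ Finset.Icc (-(L : ℤ)) L, rectTwoPoint T L Θ (.vert T j)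

/-- **`D_{T,L,Θ} = Σ_{γ : 0 → z ∈ δ} cos((3/8) wind(γ)) w(γ)`** over walks to the upper side `δ`
(the top sides `slant k (L+1)` of row `L`). [cite: GlazmanManolescu2019, eq. (2.3)] -/
def rectD (T L : ℕ) (Θ : ℤ → ℝ) : ℝ :=
  ∑ k ∈ Finset.range T, ∑ γ : YBWalk (rect T L) origin (.slant k (L + 1)),
    Real.cos (3 / 8 * γ.winding Θ) * γ.weight Θ

/-- **`E_{T,L,Θ} = Σ_{γ : 0 → z ∈ ε} cos((3/8) wind(γ)) w(γ)`** over walks to the bottom side `ε`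
(the bottom sides `slant k (−L)` of row `−L`). [cite: GlazmanManolescu2019, eq. (2.3)] -/
def rectE (T L : ℕ) (Θ : ℤ → ℝ) : ℝ :=
  ∑ k ∈ Finset.range T, ∑ γ : YBWalk (rect T L) origin (.slant k (-(L : ℤ))),
    Real.cos (3 / 8 * γ.winding Θ) * γ.weight Θ

/-! ### Named facts: the discrete Cauchy–Riemann relation and the boundary windings -/

/-- **Glazman–Manolescu, Lemma 2.1** (partial discrete holomorphicity, "in the form given in
[Gl]"). "The parafermionic observable `F` satisfies the following relation for each rhombus of
`Rect_{T,L}(Θ)`: `F(z_E) − F(z_W) = e^{iθ}(F(z_S) − F(z_N))`, where `z_E, z_S, z_W` and `z_N` are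
the midpoints of the edges of the rhombus" (of angle `θ`; `Θ` a sequence of angles in
`[π/3, 2π/3]` as fixed in §2.1). [cite: GlazmanManolescu2019, Lemma 2.1, eq. (2.2) (CR)] -/
def GlazmanManolescu2019_lem21 : Prop :=
  ∀ (T L : ℕ) (Θ : ℤ → ℝ), (∀ k, Θ k ∈ Set.Icc (π / 3) (2 * π / 3)) → ∀ f ∈ rect T L,
    parafermion T L Θ (f.side .E) - parafermion T L Θ (f.side .W) =
      Complex.exp ((Θ f.1 : ℝ) * Complex.I) * (parafermion T L Θ (f.side .S) - parafermion T L Θ (f.side .N))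

/-- **The windings of walks to the boundary** (the topological input of Lemma 2.2: Hopf's
Umlaufsatz for the simple curve `γ` closed up along `∂Rect`). For a walk of `Rect_{T,L}(Θ)` from
`0`: to another point of the left side `α` the winding is `±π`; to the right side `β` it is `0`
("the winding of any bridge is `0`"); to the top side `δ` through column `k` it is `θ_k`, to the
bottom side `ε` it is `θ_k − π` ("walks … with endpoint on `δ` and `ε` have winding in
`[π/3, 2π/3]` and `[−2π/3, −π/3]`, respectively"; "for the points on the boundary we know the
winding" [Gl, proof of Lemma 4.1]).
[cite: GlazmanManolescu2019, §2.2 (proof of Corollary 2.5) and Lemma 2.2] -/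
def GlazmanManolescu2019_boundaryWinding : Prop :=
  ∀ (T L : ℕ) (Θ : ℤ → ℝ), (∀ k, Θ k ∈ Set.Icc (π / 3) (2 * π / 3)) →
    (∀ j : ℤ, j ≠ 0 → ∀ γ : YBWalk (rect T L) origin (.vert 0 j), γ.winding Θ = π ∨ γ.winding Θ = -π) ∧
    (∀ j : ℤ, 1 ≤ T → ∀ γ : YBWalk (rect T L) origin (.vert T j), γ.winding Θ = 0) ∧
    (∀ k : ℤ, ∀ γ : YBWalk (rect T L) origin (.slant k (L + 1)), γ.winding Θ = Θ k) ∧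
    (∀ k : ℤ, ∀ γ : YBWalk (rect T L) origin (.slant k (-(L : ℤ))), γ.winding Θ = Θ k - π)

/-- **Glazman–Manolescu, Lemma 2.2** (= [Gl, Lem. 4.1]). "For any sequence `Θ = {θ_k}` of angles
between `π/3` and `2π/3`, `cos(3π/8) A_{T,L,Θ} + B_{T,L,Θ} + D_{T,L,Θ} + E_{T,L,Θ} = 1`."
(Strips of width `T ≥ 1`.) [cite: GlazmanManolescu2019, Lemma 2.2, eq. (2.4)] -/
def GlazmanManolescu2019_lem22 : Prop :=
  ∀ (T L : ℕ) (Θ : ℤ → ℝ), 1 ≤ T → (∀ k, Θ k ∈ Set.Icc (π / 3) (2 * π / 3)) →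
    Real.cos (3 * π / 8) * rectA T L Θ + rectB T L Θ + rectD T L Θ + rectE T L Θ = 1

/-! ### Lemma 2.2 from Lemma 2.1 and the boundary windings -/

/-- Reindexing a sum over the rows `−L, …, L`. [folklore] -/
theorem sum_Icc_neg_eq_sum_range {M : Type*} [AddCommMonoid M] (L : ℕ) (h : ℤ → M) :
    ∑ j ∈ Finset.Icc (-(L : ℤ)) L, h j = ∑ i ∈ Finset.range (2 * L + 1), h ((i : ℤ) - L) := by
  have : Finset.Icc (-(L : ℤ)) L = (Finset.range (2 * L + 1)).image fun i : ℕ => (i : ℤ) - L := by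
    ext x
    simp only [Finset.mem_Icc, Finset.mem_image, Finset.mem_range]
    constructor
    · intro h; exact ⟨(x + L).toNat, by omega, by omega⟩
    · rintro ⟨i, hi, rfl⟩; omega
  rw [this, Finset.sum_image fun i _ j _ h => by simpa using h]

/-- `F(0) = 1`: only the empty walk returns to `0`. [cite: GlazmanManolescu2019, Lemma 2.2 ("the factor 1 … comes from the contribution to F of the empty configuration")] -/
theorem parafermion_origin (T L : ℕ) (Θ : ℤ → ℝ) : parafermion T L Θ origin = 1 := by
  simp [parafermion, YBWalk.eq_trivial_of_self]

/-- **The discrete contour integral around the rectangle vanishes**: summing Lemma 2.1 over the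
rhombi of `Rect_{T,L}`, the interior edges cancel. [cite: GlazmanManolescu2019, Lemma 2.2 (proof)] -/
theorem rect_contour_sum (h21 : GlazmanManolescu2019_lem21) (T L : ℕ) {Θ : ℤ → ℝ}
    (hΘ : ∀ k, Θ k ∈ Set.Icc (π / 3) (2 * π / 3)) :
    ∑ j ∈ Finset.Icc (-(L : ℤ)) L, (parafermion T L Θ (.vert T j) - parafermion T L Θ (.vert 0 j)) =
      ∑ k ∈ Finset.range T, Complex.exp ((Θ k : ℝ) * Complex.I) *
        (parafermion T L Θ (.slant k (-(L : ℤ))) - parafermion T L Θ (.slant k (L + 1))) := by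
  -- sum the relation over all faces `(k, j)`
  have hface : ∀ k ∈ Finset.range T, ∀ j ∈ Finset.Icc (-(L : ℤ)) L,
      parafermion T L Θ (.vert (k + 1) j) - parafermion T L Θ (.vert k j) =
        Complex.exp ((Θ k : ℝ) * Complex.I) *
          (parafermion T L Θ (.slant k j) - parafermion T L Θ (.slant k (j + 1))) := by
    intro k hk j hj
    rw [Finset.mem_range] at hk
    rw [Finset.mem_Icc] at hj
    exact h21 T L Θ hΘ ((k : ℤ), j) ⟨by omega, by omega, hj.1, hj.2⟩
  have hsum := Finset.sum_congr rfl fun k hk => Finset.sum_congr rfl fun j hj => hface k hk j hj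
  -- left side: telescoping in `k`
  rw [Finset.sum_comm] at hsum
  have hleft : ∀ j : ℤ, ∑ k ∈ Finset.range T,
      (parafermion T L Θ (.vert (k + 1) j) - parafermion T L Θ (.vert k j)) =
      parafermion T L Θ (.vert T j) - parafermion T L Θ (.vert 0 j) := by
    intro j
    have := Finset.sum_range_sub (fun k : ℕ => parafermion T L Θ (.vert k j)) T
    simpa using this
  simp only [hleft] at hsum
  rw [hsum]
  refine Finset.sum_congr rfl fun k _ => ?_
  rw [← Finset.mul_sum, sum_Icc_neg_eq_sum_range]
  congr 1
  set f : ℕ → ℂ := fun i => parafermion T L Θ (.slant k ((i : ℤ) - L)) with hf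
  have key : ∀ i : ℕ, parafermion T L Θ (.slant k ((i : ℤ) - L + 1)) = f (i + 1) := fun i => by
    simp only [hf]; congr 2; push_cast; ring
  calc ∑ i ∈ Finset.range (2 * L + 1),
        (parafermion T L Θ (.slant k ((i : ℤ) - L)) - parafermion T L Θ (.slant k ((i : ℤ) - L + 1)))
      = ∑ i ∈ Finset.range (2 * L + 1), (f i - f (i + 1)) := Finset.sum_congr rfl fun i _ => by rw [key]
    _ = f 0 - f (2 * L + 1) := Finset.sum_range_sub' f _
    _ = parafermion T L Θ (.slant k (-(L : ℤ))) - parafermion T L Θ (.slant k (L + 1)) := by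
        simp only [hf]; congr 3 <;> push_cast <;> ring

/-- Real part of a rotated parafermionic weight: `Re[e^{iθ} w e^{-i(5/8)W}] = w cos(θ − 5W/8)`.
[folklore] -/
theorem re_exp_mul_paraWeight {D : Set Face} {a z : MidEdge} (θ : ℝ) (Θ : ℤ → ℝ) (γ : YBWalk D a z) :
    (Complex.exp ((θ : ℝ) * Complex.I) * γ.paraWeight Θ).re =
      γ.weight Θ * Real.cos (θ - 5 / 8 * γ.winding Θ) := by
  rw [YBWalk.paraWeight, mul_left_comm, ← Complex.exp_add, ← add_mul, ← Complex.ofReal_add,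
    Complex.re_ofReal_mul, Complex.exp_ofReal_mul_I_re]
  ring_nf

/-- **Lemma 2.2 from Lemma 2.1 and the boundary windings**: the real part of the vanishing
contour sum `rect_contour_sum`, with `F(0) = 1`, `Re e^{-i(5/8)(±π)} = −cos(3π/8)` on `α`,
winding `0` on `β`, `Re[e^{iθ_k} e^{-i(5/8)θ_k}] = cos(3θ_k/8)` on `δ` and
`Re[e^{iθ_k} e^{-i(5/8)(θ_k−π)}] = −cos((3/8)(θ_k − π))` on `ε`.
[cite: GlazmanManolescu2019, Lemma 2.2 (proof: "Summing the real part of (CR) over all rhombi")] -/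
theorem GlazmanManolescu2019_lem22_of (h21 : GlazmanManolescu2019_lem21)
    (hW : GlazmanManolescu2019_boundaryWinding) : GlazmanManolescu2019_lem22 := by
  intro T L Θ hT hΘ
  obtain ⟨hα, hβ, hδ, hε⟩ := hW T L Θ hΘ
  have hsum := congrArg Complex.re (rect_contour_sum h21 T L hΘ)
  rw [Complex.re_sum, Complex.re_sum] at hsum
  simp only [Complex.sub_re, mul_sub] at hsum
  -- evaluate each boundary term
  have hB : ∀ j : ℤ, (parafermion T L Θ (.vert T j)).re = rectTwoPoint T L Θ (.vert T j) := by
    intro j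
    rw [parafermion, Complex.re_sum, rectTwoPoint]
    refine Finset.sum_congr rfl fun γ _ => ?_
    rw [YBWalk.paraWeight_re, hβ j hT γ]; simp
  have hA : ∀ j : ℤ, (parafermion T L Θ (.vert 0 j)).re =
      if j = 0 then 1 else -Real.cos (3 * π / 8) * rectTwoPoint T L Θ (.vert 0 j) := by
    intro j
    split_ifs with hj
    · subst hj; rw [show MidEdge.vert 0 0 = origin from rfl, parafermion_origin]; simp
    · rw [parafermion, Complex.re_sum, rectTwoPoint, Finset.mul_sum]
      refine Finset.sum_congr rfl fun γ _ => ?_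
      rw [YBWalk.paraWeight_re]
      have hc : Real.cos (5 / 8 * γ.winding Θ) = -Real.cos (3 * π / 8) := by
        have h5 : Real.cos (5 / 8 * π) = -Real.cos (3 * π / 8) := by
          rw [show (5 / 8 * π : ℝ) = π - 3 * π / 8 by ring, Real.cos_pi_sub]
        rcases hα j hj γ with h | h <;> rw [h]
        · exact h5
        · rw [mul_neg, Real.cos_neg]; exact h5
      rw [hc]; ring
  have hD : ∀ k : ℕ, (Complex.exp ((Θ k : ℝ) * Complex.I) * parafermion T L Θ (.slant k (L + 1))).re =
      ∑ γ : YBWalk (rect T L) origin (.slant k (L + 1)), Real.cos (3 / 8 * γ.winding Θ) * γ.weight Θ := by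
    intro k
    rw [parafermion, Finset.mul_sum, Complex.re_sum]
    refine Finset.sum_congr rfl fun γ _ => ?_
    rw [re_exp_mul_paraWeight, hδ k γ, mul_comm]
    congr 1; ring_nf
  have hE : ∀ k : ℕ, (Complex.exp ((Θ k : ℝ) * Complex.I) * parafermion T L Θ (.slant k (-(L : ℤ)))).re =
      -∑ γ : YBWalk (rect T L) origin (.slant k (-(L : ℤ))), Real.cos (3 / 8 * γ.winding Θ) * γ.weight Θ := by
    intro k
    rw [parafermion, Finset.mul_sum, Complex.re_sum, ← Finset.sum_neg_distrib]
    refine Finset.sum_congr rfl fun γ _ => ?_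
    rw [re_exp_mul_paraWeight, hε k γ]
    have : Real.cos (Θ k - 5 / 8 * (Θ k - π)) = -Real.cos (3 / 8 * (Θ k - π)) := by
      rw [show Θ k - 5 / 8 * (Θ k - π) = 3 / 8 * (Θ k - π) + π by ring, Real.cos_add_pi]
    rw [this]; ring
  simp only [hB, hA, hD, hE] at hsum
  rw [Finset.sum_sub_distrib, Finset.sum_sub_distrib, Finset.sum_ite, Finset.sum_const,
    Finset.filter_eq'] at hsum
  rw [if_pos (by simp : (0 : ℤ) ∈ Finset.Icc (-(L : ℤ)) L)] at hsum
  simp only [Finset.card_singleton, one_smul] at hsum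
  -- assemble
  unfold rectA rectB rectD rectE
  have hA' : ∑ j ∈ Finset.Icc (-(L : ℤ)) L with ¬j = 0, -Real.cos (3 * π / 8) * rectTwoPoint T L Θ (.vert 0 j) =
      -Real.cos (3 * π / 8) * ∑ j ∈ Finset.Icc (-(L : ℤ)) L, (if j = 0 then 0 else rectTwoPoint T L Θ (.vert 0 j)) := by
    rw [Finset.mul_sum, Finset.sum_filter]
    refine Finset.sum_congr rfl fun j _ => ?_
    split_ifs <;> simp
  rw [hA'] at hsum
  simp only [Finset.sum_neg_distrib] at hsum
  linarith

/-! ### Exhaustion of the strip by rectangles -/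

/-- Rectangles increase with their height. [cite: GlazmanManolescu2019, §2.1] -/
theorem rect_mono {T L L' : ℕ} (h : L ≤ L') : rect T L ⊆ rect T L' :=
  fun _ hf => ⟨hf.1, hf.2.1, by have := hf.2.2.1; omega, by have := hf.2.2.2; omega⟩

/-- `L ↦ G_{Rect_{T,L}}` is non-decreasing. [cite: GlazmanManolescu2019, §2.1] -/
theorem twoPoint_rect_mono (T : ℕ) (Θ : ℤ → ℝ) (a z : MidEdge) :
    Monotone fun L : ℕ => twoPoint (rect T L) Θ a z :=
  fun _ _ h => twoPoint_mono (rect_mono h) Θ a z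

namespace YBWalk

variable {D : Set Face} {a z : MidEdge}

/-- A bound on the rows visited by a walk: every visited face `f` has `|f.2| < rowBound`. [folklore] -/
def rowBound (γ : YBWalk D a z) : ℕ := γ.facesVisited.sup fun f => f.2.natAbs + 1

/-- Visited faces lie in rows of absolute value `< rowBound`. [folklore] -/
theorem natAbs_lt_rowBound (γ : YBWalk D a z) {f : Face} (hf : f ∈ γ.facesVisited) :
    f.2.natAbs < γ.rowBound := by
  have : f.2.natAbs + 1 ≤ γ.rowBound := Finset.le_sup (f := fun f : Face => f.2.natAbs + 1) hf
  omega

/-- A walk of the strip visits only faces of the rectangle of height `rowBound`.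
[cite: GlazmanManolescu2019, proof of Corollary 2.3 ("any self-avoiding arc of Strip_T is contained in a rectangle Rect_{T,L} for L large enough")] -/
theorem mem_rect_of_mem_facesVisited {T : ℕ} (γ : YBWalk (strip T) a z) {L : ℕ} (hL : γ.rowBound ≤ L)
    {f : Face} (hf : f ∈ γ.facesVisited) : f ∈ rect T L := by
  obtain ⟨h0, hT⟩ := γ.mem_of_mem_facesVisited hf
  have := γ.natAbs_lt_rowBound hf
  exact ⟨h0, hT, by omega, by omega⟩

end YBWalk

/-- **Exhaustion of the strip by rectangles**: `G_{Strip_T}(a, z) = sup_L G_{Rect_{T,L}}(a, z)`.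
[cite: GlazmanManolescu2019, proof of Corollary 2.3 ("A_{T,Θ} = lim_{L→∞} A_{T,L,Θ}")] -/
theorem twoPoint_strip_eq_iSup_rect (T : ℕ) (Θ : ℤ → ℝ) (a z : MidEdge) :
    twoPoint (strip T) Θ a z = ⨆ L : ℕ, twoPoint (rect T L) Θ a z := by
  refine le_antisymm ?_ (iSup_le fun L => twoPoint_mono (rect_subset_strip T L) Θ a z)
  unfold twoPoint
  rw [ENNReal.tsum_eq_iSup_sum]
  refine iSup_le fun s => ?_
  set L : ℕ := s.sup YBWalk.rowBound with hL
  let φ : YBWalk (rect T L) a z → YBWalk (strip T) a z := YBWalk.mapDomain (rect_subset_strip T L)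
  have hφ : Function.Injective φ := YBWalk.mapDomain_injective _
  have hrange : ∀ γ ∈ s, γ ∈ Set.range φ := fun γ hγ =>
    ⟨γ.restrict (rect T L) fun f hf => γ.mem_rect_of_mem_facesVisited (Finset.le_sup hγ) hf, rfl⟩
  calc ∑ γ ∈ s, ENNReal.ofReal (γ.weight Θ)
      = ∑ γ ∈ s.preimage φ hφ.injOn, ENNReal.ofReal ((φ γ).weight Θ) :=
        (Finset.sum_preimage φ s hφ.injOn (fun γ => ENNReal.ofReal (γ.weight Θ))
          (fun γ hγ hn => absurd (hrange γ hγ) hn)).symm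
    _ ≤ ∑' γ : YBWalk (rect T L) a z, ENNReal.ofReal (γ.weight Θ) := by
        simp only [φ, YBWalk.weight_mapDomain]; exact ENNReal.sum_le_tsum _
    _ ≤ ⨆ L : ℕ, ∑' γ : YBWalk (rect T L) a z, ENNReal.ofReal (γ.weight Θ) :=
        le_iSup (fun L : ℕ => ∑' γ : YBWalk (rect T L) a z, ENNReal.ofReal (γ.weight Θ)) L

/-- In a rectangle the two-point function is the finite real sum `rectTwoPoint`.
[cite: GlazmanManolescu2019, §2.1] -/
theorem twoPoint_rect_eq_ofReal (T L : ℕ) {Θ : ℤ → ℝ} (hΘ : ∀ k, Θ k ∈ Set.Icc (π / 3) (2 * π / 3))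
    (z : MidEdge) : twoPoint (rect T L) Θ origin z = ENNReal.ofReal (rectTwoPoint T L Θ z) := by
  rw [twoPoint, tsum_fintype, rectTwoPoint, ENNReal.ofReal_sum_of_nonneg fun γ _ => γ.weight_nonneg hΘ]

/-- `rectTwoPoint ≥ 0`. [cite: GlazmanManolescu2019, §1] -/
theorem rectTwoPoint_nonneg (T L : ℕ) {Θ : ℤ → ℝ} (hΘ : ∀ k, Θ k ∈ Set.Icc (π / 3) (2 * π / 3))
    (z : MidEdge) : 0 ≤ rectTwoPoint T L Θ z :=
  Finset.sum_nonneg fun γ _ => γ.weight_nonneg hΘ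

/-- The last mid-edge of a walk of `Rect_{T,L}` from `0`, if vertical, lies in a row `|j| ≤ L`.
[folklore] -/
theorem YBWalk.row_le_of_vert {T L : ℕ} {k j : ℤ} (γ : YBWalk (rect T L) origin (.vert k j)) :
    -(L : ℤ) ≤ j ∧ j ≤ L :=
  γ.vert_row_le (List.mem_of_mem_getLast? (by rw [Option.mem_def, γ.getLast_eq]))

/-- No walk of `Rect_{T,L}` from `0` ends on the left or right boundary outside the rows
`−L, …, L`. [folklore] -/
theorem isEmpty_walk_vert {T L : ℕ} {k j : ℤ} (hj : j < -(L : ℤ) ∨ (L : ℤ) < j) :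
    IsEmpty (YBWalk (rect T L) origin (.vert k j)) :=
  ⟨fun γ => by have := γ.row_le_of_vert; omega⟩

/-- `A_{T,L,Θ}` as a series over all rows (the rows `|j| > L` do not contribute).
[cite: GlazmanManolescu2019, eq. (2.2)] -/
theorem ofReal_rectA_eq_tsum (T L : ℕ) {Θ : ℤ → ℝ} (hΘ : ∀ k, Θ k ∈ Set.Icc (π / 3) (2 * π / 3)) :
    ENNReal.ofReal (rectA T L Θ) = ∑' j : ℤ, if j = 0 then 0 else twoPoint (rect T L) Θ origin (.vert 0 j) := by
  rw [rectA, ENNReal.ofReal_sum_of_nonneg, ← Finset.tsum_subtype]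
  · rw [← tsum_subtype_eq_of_support_subset (f := fun j : ℤ => if j = 0 then (0 : ℝ≥0∞) else
        twoPoint (rect T L) Θ origin (.vert 0 j)) (s := (↑(Finset.Icc (-(L : ℤ)) L) : Set ℤ))]
    · refine tsum_congr fun j => ?_
      split_ifs
      · simp
      · rw [twoPoint_rect_eq_ofReal T L hΘ]
    · intro j hj
      rw [Function.mem_support] at hj
      simp only [Finset.coe_Icc, Set.mem_Icc]
      by_contra hc
      apply hj
      split_ifs
      · rfl
      · haveI := isEmpty_walk_vert (T := T) (L := L) (k := 0) (j := j) (by omega)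
        simp [twoPoint]
  · intro j _
    split_ifs
    · exact le_rfl
    · exact rectTwoPoint_nonneg T L hΘ _

/-- `B_{T,L,Θ}` as a series over all rows. [cite: GlazmanManolescu2019, eq. (2.2)] -/
theorem ofReal_rectB_eq_tsum (T L : ℕ) {Θ : ℤ → ℝ} (hΘ : ∀ k, Θ k ∈ Set.Icc (π / 3) (2 * π / 3)) :
    ENNReal.ofReal (rectB T L Θ) = ∑' j : ℤ, twoPoint (rect T L) Θ origin (.vert T j) := by
  rw [rectB, ENNReal.ofReal_sum_of_nonneg fun j _ => rectTwoPoint_nonneg T L hΘ _, ← Finset.tsum_subtype]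
  rw [← tsum_subtype_eq_of_support_subset (f := fun j : ℤ => twoPoint (rect T L) Θ origin (.vert T j))
      (s := (↑(Finset.Icc (-(L : ℤ)) L) : Set ℤ))]
  · exact tsum_congr fun j => by rw [twoPoint_rect_eq_ofReal T L hΘ]
  · intro j hj
    rw [Function.mem_support] at hj
    simp only [Finset.coe_Icc, Set.mem_Icc]
    by_contra hc
    apply hj
    haveI := isEmpty_walk_vert (T := T) (L := L) (k := T) (j := j) (by omega)
    simp [twoPoint]

/-- **`A_{T,Θ} = sup_L A_{T,L,Θ}`** (increasing limit). [cite: GlazmanManolescu2019, proof of Corollary 2.3] -/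
theorem arcPartitionFunction_eq_iSup (T : ℕ) {Θ : ℤ → ℝ} (hΘ : ∀ k, Θ k ∈ Set.Icc (π / 3) (2 * π / 3)) :
    arcPartitionFunction T Θ = ⨆ L : ℕ, ENNReal.ofReal (rectA T L Θ) := by
  unfold arcPartitionFunction
  have hterm : ∀ j : ℤ, (if j = 0 then 0 else twoPoint (strip T) Θ origin (boundaryPoint j)) =
      ⨆ L : ℕ, if j = 0 then 0 else twoPoint (rect T L) Θ origin (.vert 0 j) := by
    intro j
    split_ifs
    · simp
    · exact twoPoint_strip_eq_iSup_rect T Θ origin _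
  simp only [hterm, ofReal_rectA_eq_tsum T _ hΘ]
  rw [← iSup_tsum_eq_tsum_iSup_of_monotone]
  intro j L L' h
  dsimp only
  split_ifs
  · exact le_rfl
  · exact twoPoint_rect_mono T Θ _ _ h

/-- **`B_{T,Θ} = sup_L B_{T,L,Θ}`** (increasing limit). [cite: GlazmanManolescu2019, proof of Corollary 2.3] -/
theorem bridgePartitionFunction_eq_iSup (T : ℕ) {Θ : ℤ → ℝ}
    (hΘ : ∀ k, Θ k ∈ Set.Icc (π / 3) (2 * π / 3)) :
    bridgePartitionFunction T Θ = ⨆ L : ℕ, ENNReal.ofReal (rectB T L Θ) := by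
  unfold bridgePartitionFunction
  simp only [twoPoint_strip_eq_iSup_rect T Θ origin, ofReal_rectB_eq_tsum T _ hΘ]
  rw [← iSup_tsum_eq_tsum_iSup_of_monotone fun j => twoPoint_rect_mono T Θ origin _]

/-! ### Corollary 2.3 from Lemma 2.2 -/

section Cor23

variable {Θ : ℤ → ℝ} (hΘ : ∀ k, Θ k ∈ Set.Icc (π / 3) (2 * π / 3))
include hΘ

/-- `L ↦ A_{T,L,Θ}` is non-decreasing (in `ℝ≥0∞`). [cite: GlazmanManolescu2019, proof of Corollary 2.3] -/
theorem ofReal_rectA_mono (T : ℕ) : Monotone fun L : ℕ => ENNReal.ofReal (rectA T L Θ) := by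
  intro L L' h
  simp only [ofReal_rectA_eq_tsum T _ hΘ]
  refine ENNReal.tsum_le_tsum fun j => ?_
  split_ifs
  · exact le_rfl
  · exact twoPoint_rect_mono T Θ _ _ h

/-- `L ↦ B_{T,L,Θ}` is non-decreasing (in `ℝ≥0∞`). [cite: GlazmanManolescu2019, proof of Corollary 2.3] -/
theorem ofReal_rectB_mono (T : ℕ) : Monotone fun L : ℕ => ENNReal.ofReal (rectB T L Θ) := by
  intro L L' h
  simp only [ofReal_rectB_eq_tsum T _ hΘ]
  exact ENNReal.tsum_le_tsum fun j => twoPoint_rect_mono T Θ _ _ h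

/-- `cos((3/8) wind) ≥ 0` for walks to the top side (winding `θ_k ∈ [π/3, 2π/3]`), so `D ≥ 0`.
[cite: GlazmanManolescu2019, proof of Corollary 2.3 ("0 ≤ D_{T,L,Θ}")] -/
theorem rectD_nonneg (hW : GlazmanManolescu2019_boundaryWinding) (T L : ℕ) : 0 ≤ rectD T L Θ := by
  obtain ⟨-, -, hδ, -⟩ := hW T L Θ hΘ
  refine Finset.sum_nonneg fun k _ => Finset.sum_nonneg fun γ _ => mul_nonneg ?_ (γ.weight_nonneg hΘ)
  rw [hδ k γ]
  obtain ⟨h1, h2⟩ := hΘ k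
  exact Real.cos_nonneg_of_mem_Icc ⟨by linarith [Real.pi_pos], by linarith [Real.pi_pos]⟩

/-- `cos((3/8) wind) ≥ 0` for walks to the bottom side (winding `θ_k − π ∈ [−2π/3, −π/3]`), so
`E ≥ 0`. [cite: GlazmanManolescu2019, proof of Corollary 2.3] -/
theorem rectE_nonneg (hW : GlazmanManolescu2019_boundaryWinding) (T L : ℕ) : 0 ≤ rectE T L Θ := by
  obtain ⟨-, -, -, hε⟩ := hW T L Θ hΘ
  refine Finset.sum_nonneg fun k _ => Finset.sum_nonneg fun γ _ => mul_nonneg ?_ (γ.weight_nonneg hΘ)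
  rw [hε k γ]
  obtain ⟨h1, h2⟩ := hΘ k
  exact Real.cos_nonneg_of_mem_Icc ⟨by linarith [Real.pi_pos], by linarith [Real.pi_pos]⟩

/-- **The boundary terms are controlled by the two-point function of the next row**:
`Σ_γ w(γ)` over walks of `Rect_{T,L}` from `0` to `slant k r₀` is at most `m^{-T} G_{Strip_T}(0, vert 0 r)`,
by completing each walk along row `r`. [cite: GlazmanManolescu2019, proof of Corollary 2.3 ("0 ≤ D_{T,L,Θ} ≤ c^T cos(π/8) G_{S_T(Θ)}(0, L+1)")] -/
theorem ofReal_sum_weight_le {T L : ℕ} {z : MidEdge} (k : ℕ) (hk : k < T) (r : ℤ) (hr : (L : ℤ) < r ∨ r < -(L : ℤ))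
    (hz : arcFace (z, .vert k r) = some ((k : ℤ), r)) :
    ENNReal.ofReal (∑ γ : YBWalk (rect T L) origin z, Real.cos (3 / 8 * γ.winding Θ) * γ.weight Θ) ≤
      ENNReal.ofReal ((sin (π / 8) ^ 2 / 2) ^ T)⁻¹ * twoPoint (strip T) Θ origin (.vert 0 r) := by
  obtain ⟨hm0, hm1⟩ := sin_sq_div_two_pos_le_one
  set m : ℝ := sin (π / 8) ^ 2 / 2
  have hmT : 0 < m ^ T := pow_pos hm0 T
  -- real bound walk by walk
  have h1 : ∑ γ : YBWalk (rect T L) origin z, Real.cos (3 / 8 * γ.winding Θ) * γ.weight Θ ≤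
      (m ^ T)⁻¹ * ∑ γ : YBWalk (rect T L) origin z, (γ.completeRow k hk r hr hz).weight Θ := by
    rw [Finset.mul_sum]
    refine Finset.sum_le_sum fun γ _ => ?_
    have hw := γ.weight_nonneg hΘ
    have hc := γ.weight_completeRow_ge k hk r hr hz hΘ hm0.le hm1 fun θ hθ s t hst =>
      localWeight_singleton_ge hθ hst
    calc Real.cos (3 / 8 * γ.winding Θ) * γ.weight Θ ≤ 1 * γ.weight Θ :=
          mul_le_mul_of_nonneg_right (Real.cos_le_one _) hw
      _ = (m ^ T)⁻¹ * (γ.weight Θ * m ^ T) := by field_simp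
      _ ≤ (m ^ T)⁻¹ * (γ.completeRow k hk r hr hz).weight Θ :=
          mul_le_mul_of_nonneg_left hc (inv_nonneg.2 hmT.le)
  calc ENNReal.ofReal _ ≤ ENNReal.ofReal ((m ^ T)⁻¹ * ∑ γ : YBWalk (rect T L) origin z,
        (γ.completeRow k hk r hr hz).weight Θ) := ENNReal.ofReal_le_ofReal h1
    _ = ENNReal.ofReal (m ^ T)⁻¹ * ∑ γ : YBWalk (rect T L) origin z,
        ENNReal.ofReal ((γ.completeRow k hk r hr hz).weight Θ) := by
        rw [ENNReal.ofReal_mul (inv_nonneg.2 hmT.le), ENNReal.ofReal_sum_of_nonneg]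
        exact fun γ _ => YBWalk.weight_nonneg _ hΘ
    _ ≤ ENNReal.ofReal (m ^ T)⁻¹ * twoPoint (strip T) Θ origin (.vert 0 r) := by
        gcongr
        rw [twoPoint]
        exact (ENNReal.sum_le_tsum _).trans (ENNReal.tsum_comp_le_tsum_of_injective
          (YBWalk.completeRow_injective k hk r hr hz)
          (fun δ : YBWalk (strip T) origin (.vert 0 r) => ENNReal.ofReal (δ.weight Θ)))

/-- `D_{T,L,Θ} ≤ T m^{-T} G_{Strip_T}(0, vert 0 (L+1))`. [cite: GlazmanManolescu2019, proof of Corollary 2.3] -/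
theorem ofReal_rectD_le (T L : ℕ) :
    ENNReal.ofReal (rectD T L Θ) ≤ T * (ENNReal.ofReal ((sin (π / 8) ^ 2 / 2) ^ T)⁻¹ *
      twoPoint (strip T) Θ origin (.vert 0 ((L : ℤ) + 1))) := by
  unfold rectD
  calc _ ≤ ∑ k ∈ Finset.range T, ENNReal.ofReal (∑ γ : YBWalk (rect T L) origin (.slant k (L + 1)),
          Real.cos (3 / 8 * γ.winding Θ) * γ.weight Θ) :=
        Finset.le_sum_of_subadditive _ ENNReal.ofReal_zero.le (fun _ _ => ENNReal.ofReal_add_le) _ _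
    _ ≤ ∑ _k ∈ Finset.range T, ENNReal.ofReal ((sin (π / 8) ^ 2 / 2) ^ T)⁻¹ *
          twoPoint (strip T) Θ origin (.vert 0 ((L : ℤ) + 1)) := by
        refine Finset.sum_le_sum fun k hk => ?_
        exact ofReal_sum_weight_le hΘ k (Finset.mem_range.1 hk) _ (Or.inl (by omega))
          (arcFace_slant_vert_top k _)
    _ = _ := by rw [Finset.sum_const, Finset.card_range, nsmul_eq_mul]

/-- `E_{T,L,Θ} ≤ T m^{-T} G_{Strip_T}(0, vert 0 (−L−1))`. [cite: GlazmanManolescu2019, proof of Corollary 2.3] -/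
theorem ofReal_rectE_le (T L : ℕ) :
    ENNReal.ofReal (rectE T L Θ) ≤ T * (ENNReal.ofReal ((sin (π / 8) ^ 2 / 2) ^ T)⁻¹ *
      twoPoint (strip T) Θ origin (.vert 0 (-(L : ℤ) - 1))) := by
  unfold rectE
  calc _ ≤ ∑ k ∈ Finset.range T, ENNReal.ofReal (∑ γ : YBWalk (rect T L) origin (.slant k (-(L : ℤ))),
          Real.cos (3 / 8 * γ.winding Θ) * γ.weight Θ) :=
        Finset.le_sum_of_subadditive _ ENNReal.ofReal_zero.le (fun _ _ => ENNReal.ofReal_add_le) _ _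
    _ ≤ ∑ _k ∈ Finset.range T, ENNReal.ofReal ((sin (π / 8) ^ 2 / 2) ^ T)⁻¹ *
          twoPoint (strip T) Θ origin (.vert 0 (-(L : ℤ) - 1)) := by
        refine Finset.sum_le_sum fun k hk => ?_
        refine ofReal_sum_weight_le hΘ k (Finset.mem_range.1 hk) _ (Or.inr (by omega)) ?_
        have := arcFace_slant_vert_bottom k (-(L : ℤ) - 1)
        rwa [show -(L : ℤ) - 1 + 1 = -(L : ℤ) by ring] at this
    _ = _ := by rw [Finset.sum_const, Finset.card_range, nsmul_eq_mul]

omit hΘ in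
/-- **`G_{Strip_T}(0, vert 0 j) → 0` as `|j| → ∞` once `A_{T,Θ} < ∞`** ("which implies that
`G_{S_T(Θ)}(0, L+1)` converges to `0` as `L → ∞`"). [cite: GlazmanManolescu2019, proof of Corollary 2.3] -/
theorem tendsto_twoPoint_cofinite (T : ℕ) (hA : arcPartitionFunction T Θ ≠ ⊤) :
    Tendsto (fun j : ℤ => twoPoint (strip T) Θ origin (.vert 0 j)) cofinite (𝓝 0) := by
  apply ENNReal.tendsto_cofinite_zero_of_tsum_ne_top
  have hle : ∑' j : ℤ, twoPoint (strip T) Θ origin (.vert 0 j) ≤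
      arcPartitionFunction T Θ + ∑' j : ℤ, if j = 0 then 1 else 0 := by
    rw [arcPartitionFunction, ← ENNReal.tsum_add]
    refine ENNReal.tsum_le_tsum fun j => ?_
    split_ifs with hj
    · subst hj; rw [show MidEdge.vert 0 0 = origin from rfl, twoPoint_self]; simp
    · simp [boundaryPoint]
  refine ne_top_of_le_ne_top ?_ hle
  rw [tsum_ite_eq]
  exact ENNReal.add_ne_top.2 ⟨hA, ENNReal.one_ne_top⟩

omit hΘ in
/-- **Glazman–Manolescu, Corollary 2.3 from Lemma 2.2 (and the boundary windings, for the signs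
of `D` and `E`)**: `A_{T,Θ} = lim A_{T,L,Θ}`, `B_{T,Θ} = lim B_{T,L,Θ}` (increasing limits), and
`D_{T,L,Θ}, E_{T,L,Θ} → 0` because each walk to the top or bottom side can be completed, at a
cost `≥ c^T`, into a walk of the strip back to the boundary point `L + 1` (resp. `−L − 1`), whose
total weight tends to `0` since `Σ_L G_{S_T(Θ)}(0, L) = A_{T,Θ} ≤ 1/cos(3π/8) < ∞`.
[cite: GlazmanManolescu2019, Corollary 2.3 (proof)] -/
theorem GlazmanManolescu2019_cor23_of (h22 : GlazmanManolescu2019_lem22)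
    (hW : GlazmanManolescu2019_boundaryWinding) : GlazmanManolescu2019_cor23 := by
  intro Θ hΘ T hT
  set c : ℝ≥0∞ := ENNReal.ofReal (Real.cos (3 * π / 8)) with hc
  have hc0 : c ≠ 0 := by simpa [hc] using cos_three_pi_div_eight_pos
  have hcos := cos_three_pi_div_eight_pos
  have hD0 := rectD_nonneg hΘ hW T
  have hE0 := rectE_nonneg hΘ hW T
  have h22L : ∀ L, Real.cos (3 * π / 8) * rectA T L Θ + rectB T L Θ = 1 - rectD T L Θ - rectE T L Θ :=
    fun L => by linarith [h22 T L Θ hT hΘ]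
  have hA0 : ∀ L, 0 ≤ rectA T L Θ := fun L => by
    have := ofReal_rectA_eq_tsum T L hΘ  -- nonnegativity from the definition
    exact Finset.sum_nonneg fun j _ => by split_ifs; exacts [le_rfl, Finset.sum_nonneg fun γ _ => γ.weight_nonneg hΘ]
  have hB0 : ∀ L, 0 ≤ rectB T L Θ := fun L => Finset.sum_nonneg fun j _ => Finset.sum_nonneg fun γ _ => γ.weight_nonneg hΘ
  -- the quantity `c A_{T,L} + B_{T,L}` in `ℝ≥0∞`
  have hsumL : ∀ L, c * ENNReal.ofReal (rectA T L Θ) + ENNReal.ofReal (rectB T L Θ) =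
      ENNReal.ofReal (1 - rectD T L Θ - rectE T L Θ) := by
    intro L
    rw [hc, ← ENNReal.ofReal_mul hcos.le, ← ENNReal.ofReal_add (mul_nonneg hcos.le (hA0 L)) (hB0 L), h22L]
  have hlim : c * arcPartitionFunction T Θ + bridgePartitionFunction T Θ =
      ⨆ L : ℕ, (c * ENNReal.ofReal (rectA T L Θ) + ENNReal.ofReal (rectB T L Θ)) := by
    rw [arcPartitionFunction_eq_iSup T hΘ, bridgePartitionFunction_eq_iSup T hΘ, ENNReal.mul_iSup,
      ENNReal.iSup_add_iSup_of_monotone]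
    · exact fun L L' h => mul_le_mul' le_rfl (ofReal_rectA_mono hΘ T h)
    · exact ofReal_rectB_mono hΘ T
  -- upper bound
  have hup : c * arcPartitionFunction T Θ + bridgePartitionFunction T Θ ≤ 1 := by
    rw [hlim]
    refine iSup_le fun L => ?_
    rw [hsumL, ← ENNReal.ofReal_one]
    exact ENNReal.ofReal_le_ofReal (by linarith [hD0 L, hE0 L])
  refine le_antisymm hup ?_
  -- `A_{T,Θ} < ∞`, hence the next-row two-point functions tend to `0`
  have hAfin : arcPartitionFunction T Θ ≠ ⊤ := by
    intro h
    rw [h, ENNReal.mul_top hc0, top_add] at hup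
    exact absurd hup (by simp)
  have hcof := tendsto_twoPoint_cofinite T hAfin
  have h1 : Tendsto (fun L : ℕ => (L : ℤ) + 1) atTop atTop :=
    tendsto_atTop_atTop.2 fun b => ⟨b.toNat, fun L hL => by omega⟩
  have h2 : Tendsto (fun L : ℕ => -(L : ℤ) - 1) atTop atBot :=
    tendsto_atTop_atBot.2 fun b => ⟨(-b).toNat, fun L hL => by omega⟩
  have htop := hcof.comp (h1.mono_right atTop_le_cofinite)
  have hbot := hcof.comp (h2.mono_right atBot_le_cofinite)
  -- hence `D, E → 0`
  set C : ℝ≥0∞ := ENNReal.ofReal ((sin (π / 8) ^ 2 / 2) ^ T)⁻¹ with hC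
  have hCtop : C ≠ ⊤ := ENNReal.ofReal_ne_top
  have hTtop : (T : ℝ≥0∞) ≠ ⊤ := ENNReal.natCast_ne_top T
  have hDlim : Tendsto (fun L : ℕ => ENNReal.ofReal (rectD T L Θ)) atTop (𝓝 0) := by
    have h := (ENNReal.Tendsto.const_mul htop (Or.inr hCtop))
    have h' := ENNReal.Tendsto.const_mul h (Or.inr hTtop)
    simp only [mul_zero] at h'
    exact tendsto_of_tendsto_of_tendsto_of_le_of_le tendsto_const_nhds h' (fun L => zero_le)
      fun L => ofReal_rectD_le hΘ T L
  have hElim : Tendsto (fun L : ℕ => ENNReal.ofReal (rectE T L Θ)) atTop (𝓝 0) := by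
    have h := (ENNReal.Tendsto.const_mul hbot (Or.inr hCtop))
    have h' := ENNReal.Tendsto.const_mul h (Or.inr hTtop)
    simp only [mul_zero] at h'
    exact tendsto_of_tendsto_of_tendsto_of_le_of_le tendsto_const_nhds h' (fun L => zero_le)
      fun L => ofReal_rectE_le hΘ T L
  -- back to real numbers
  have toReal_lim : ∀ {u : ℕ → ℝ}, (∀ L, 0 ≤ u L) → Tendsto (fun L => ENNReal.ofReal (u L)) atTop (𝓝 0) →
      Tendsto u atTop (𝓝 0) := by
    intro u hu h
    have := (ENNReal.tendsto_toReal ENNReal.zero_ne_top).comp h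
    simp only [ENNReal.toReal_zero] at this
    refine this.congr fun L => ?_
    simp [ENNReal.toReal_ofReal (hu L)]
  have hDlim' := toReal_lim hD0 hDlim
  have hElim' := toReal_lim hE0 hElim
  have hone : Tendsto (fun L : ℕ => ENNReal.ofReal (1 - rectD T L Θ - rectE T L Θ)) atTop (𝓝 1) := by
    rw [← ENNReal.ofReal_one]
    refine ENNReal.tendsto_ofReal ?_
    have := (tendsto_const_nhds (x := (1 : ℝ))).sub (hDlim'.add hElim')
    simpa [sub_sub] using this
  refine le_of_tendsto' hone fun L => ?_
  rw [← hsumL, hlim]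
  exact le_iSup (fun L : ℕ => c * ENNReal.ofReal (rectA T L Θ) + ENNReal.ofReal (rectB T L Θ)) L

end Cor23

/-! ### Theorems 1 and 2 from Lemma 2.1, the boundary windings, Proposition 1.1 and Proposition 4.2 -/

/-- **Theorem 1 from Lemma 2.1, the boundary windings, `B_T(π/3) → 0` and Proposition 4.2.**
[cite: GlazmanManolescu2019, Theorem 1 (proof, §4.2)] -/
theorem GlazmanManolescu2019_thm1_of_lem21 (h21 : GlazmanManolescu2019_lem21)
    (hW : GlazmanManolescu2019_boundaryWinding) (h11 : GlazmanManolescu2019_prop11_limit)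
    (h42 : GlazmanManolescu2019_prop42) : GlazmanManolescu2019_thm1 :=
  GlazmanManolescu2019_thm1_of_cor23_prop11_prop42
    (GlazmanManolescu2019_cor23_of (GlazmanManolescu2019_lem22_of h21 hW) hW) h11 h42

/-- **Theorem 2 from Lemma 2.1, the boundary windings, `B_T(π/3) → 0` and Proposition 4.2.**
[cite: GlazmanManolescu2019, Theorem 2 (proof, §4.3)] -/
theorem GlazmanManolescu2019_thm2_of_lem21 (h21 : GlazmanManolescu2019_lem21)
    (hW : GlazmanManolescu2019_boundaryWinding) (h11 : GlazmanManolescu2019_prop11_limit)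
    (h42 : GlazmanManolescu2019_prop42) : GlazmanManolescu2019_thm2 :=
  GlazmanManolescu2019_thm2_of_cor23_prop11_prop42
    (GlazmanManolescu2019_cor23_of (GlazmanManolescu2019_lem22_of h21 hW) hW) h11 h42

end Literature.Probability.RandomPlanarGeometry.SAW.YangBaxter
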